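import Summits.CriticalPhenomena.PercolationContinuityZ3.Theorems.PercNearOneGluingAdditiveGluingKnThm2GoodAux
import Summits.CriticalPhenomena.PercolationContinuityZ3.Theorems.PercNearOneGluingAdditiveGluingBhkSets
import HarnessLib

/-!
# Crux `PercNearOneGluing.AdditiveGluing` (stmt-CriticalPhenomena-4576): the van den Berg–Häggström–Kahn CLASS BOUND for the gluing gain

Support file (`--supports stmt-CriticalPhenomena-4576`, depth prover `png-dp-al5`, gen g3).  No definitions, no named facts, no sorries.

For a finite weighted graph (`μ = prodBernoulli w` on `Fin n`), a relay set `S`, target `b` and observer `o`, the GLUING GAIN event of `o`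
is `Γ_o(S) = (⋃_{a∈S} {o↔a}) ∩ {o↮b} ∩ (⋃_{a∈S} {a↔b})` (the observer reaches `S`, not `b`, and `S` reaches `b`; its probability is
`μ_{G/S}(o↔b) − μ_G(o↔b)`).  Decompose it by the CLASS `T := {t ∈ S : t ↔ b}` of the target: on `Γ_o(S)` the class `T` is a nonempty proper
subset of `S`, no vertex of `S ∖ T` is joined to a vertex of `T` (it would then be joined to `b`), `b` is joined to EVERY vertex of `T`, and `o` is
joined to SOME vertex of `S ∖ T` (`gluingGain_subset_iUnion_class`).  On each piece the two-SET van den Berg–Häggström–Kahn inequality given the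
separation `W_T = {S∖T ↮ T}` (landed `knThm2_bhkTwo`, fed by `stub_bhkSets`: `{o ↔ some s ∈ S∖T}` and `{b ↔ every t ∈ T}` are negatively correlated
given `W_T`) bounds the piece by `μ(W_T ∩ {b ↔ all of T}) · μ(W_T ∩ {o ↔ some of S∖T}) / μ(W_T)`.  Summing (union bound):

* `gluingGain_le_classBound` (**the class bound**):
  `μ(Γ_o(S)) ≤ B_o(S) := Σ_{∅≠T⊊S} μ(C_b ∩ S = T) · μ(o ↔ S∖T | T ↮ S∖T)`
  (here `{C_b ∩ S = T} = W_T ∩ {b ↔ all of T}` and the conditional probability is the real quotient, `x/0 = 0`).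

For `|S| = 2` the class bound proves Kozma–Nitzan's Lemma 4 (`B_o = M_u q + M_v q' ≤ M_v ≤ μ(S↔b) − τ(u)`); for `|S| = 3` it can EXCEED the gluing
budget `μ(S↔b) − min_S τ` (certified witness: `not_classBoundBudget_three`, file `…ClassBoundCex.lean`), so the class decomposition alone does not
prove CAG / `AdditiveGluing` beyond pairs.  [cite: VandenbergHaggstromKahn2005, Thms. 1.4–1.5 (p. 7)] [cite: KozmaNitzan2024, Lemma 4 (p. 9), Question 7 (p. 36)]
-/

namespace Summit.CriticalPhenomena.PercolationContinuityZ3.Theorems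

open MeasureTheory Set Literature.Probability.LatticeModels Literature.Probability.Percolation

noncomputable section
open Classical

variable {n : ℕ}

/-- **Class decomposition of the gluing gain (covering form).**  If `o` is joined to `S` but not to `b` and `S` is joined to `b`, then with
`T = {t ∈ S : t ↔ b}` (nonempty, proper): no vertex of `S ∖ T` is joined to a vertex of `T`, `b` is joined to every vertex of `T`, and `o` is
joined to some vertex of `S ∖ T`. [folklore] -/
theorem gluingGain_subset_iUnion_class (S : Finset (Fin n)) (o b : Fin n) :
    ((⋃ a ∈ S, openConn o a) ∩ (openConn o b)ᶜ ∩ (⋃ a ∈ S, openConn a b) : Set (BondConfig (Fin n))) ⊆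
      ⋃ T ∈ S.powerset.filter (fun T => T.Nonempty ∧ T ≠ S),
        ({ω : BondConfig (Fin n) | ∀ s ∈ S \ T, ∀ x ∈ T, ¬ (openGraph ω).Reachable s x} ∩
          ((⋃ s ∈ S \ T, openConn s o) ∩ ⋂ t ∈ T, openConn t b)) := by
  intro ω hω
  obtain ⟨⟨hOA, hOb⟩, hAB⟩ := hω
  simp only [Set.mem_iUnion, exists_prop] at hOA hAB
  obtain ⟨a, haS, hoa⟩ := hOA
  obtain ⟨a', ha'S, ha'b⟩ := hAB
  have hoa' : (openGraph ω).Reachable o a := hoa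
  have ha'b' : (openGraph ω).Reachable a' b := ha'b
  have hob : ¬ (openGraph ω).Reachable o b := hOb
  set T : Finset (Fin n) := S.filter (fun t => (openGraph ω).Reachable t b) with hT
  have hmemT : ∀ t, t ∈ T ↔ t ∈ S ∧ (openGraph ω).Reachable t b := fun t => by
    rw [hT, Finset.mem_filter]
  have haT : a ∉ T := fun h => hob (hoa'.trans ((hmemT a).1 h).2)
  simp only [Set.mem_iUnion, exists_prop]
  refine ⟨T, ?_, ?_⟩
  · rw [Finset.mem_filter, Finset.mem_powerset]
    refine ⟨fun t ht => ((hmemT t).1 ht).1, ⟨a', (hmemT a').2 ⟨ha'S, ha'b'⟩⟩, ?_⟩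
    intro hTS
    exact haT (hTS ▸ haS)
  · refine ⟨?_, ?_, ?_⟩
    · intro s hs x hx hsx
      rw [Finset.mem_sdiff] at hs
      exact hs.2 ((hmemT s).2 ⟨hs.1, hsx.trans ((hmemT x).1 hx).2⟩)
    · simp only [Set.mem_iUnion, exists_prop]
      exact ⟨a, Finset.mem_sdiff.2 ⟨haS, haT⟩, (hoa'.symm : (openGraph ω).Reachable a o)⟩
    · simp only [Set.mem_iInter]
      intro t ht
      exact (((hmemT t).1 ht).2 : (openGraph ω).Reachable t b)

/-- **The class bound for the gluing gain** (van den Berg–Häggström–Kahn two-set repulsion, class by class, plus the union bound):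
`μ(o↔S, o↮b, S↔b) ≤ Σ_{∅≠T⊊S} μ(W_T ∩ {b ↔ all of T}) · μ(W_T ∩ {o ↔ some of S∖T}) / μ(W_T)`, `W_T = {S∖T ↮ T}`
(`= Σ_T μ(C_b ∩ S = T)·μ(o ↔ S∖T | T ↮ S∖T)`). [cite: VandenbergHaggstromKahn2005, Thms. 1.4–1.5 (p. 7)] -/
theorem gluingGain_le_classBound (w : Sym2 (Fin n) → unitInterval) (S : Finset (Fin n)) (o b : Fin n) :
    (prodBernoulli w).real ((⋃ a ∈ S, openConn o a) ∩ (openConn o b)ᶜ ∩ (⋃ a ∈ S, openConn a b)) ≤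
      ∑ T ∈ S.powerset.filter (fun T => T.Nonempty ∧ T ≠ S),
        (prodBernoulli w).real
            ({ω : BondConfig (Fin n) | ∀ s ∈ S \ T, ∀ x ∈ T, ¬ (openGraph ω).Reachable s x} ∩ ⋂ t ∈ T, openConn t b) *
          ((prodBernoulli w).real
              ({ω : BondConfig (Fin n) | ∀ s ∈ S \ T, ∀ x ∈ T, ¬ (openGraph ω).Reachable s x} ∩ ⋃ s ∈ S \ T, openConn s o) /
            (prodBernoulli w).real {ω : BondConfig (Fin n) | ∀ s ∈ S \ T, ∀ x ∈ T, ¬ (openGraph ω).Reachable s x}) := by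
  refine (measureReal_mono (gluingGain_subset_iUnion_class S o b) (measure_ne_top _ _)).trans ?_
  refine (measureReal_biUnion_finset_le _ _).trans (Finset.sum_le_sum fun T _ => ?_)
  set μ := prodBernoulli w with hμ
  set W : Set (BondConfig (Fin n)) := {ω | ∀ s ∈ S \ T, ∀ x ∈ T, ¬ (openGraph ω).Reachable s x} with hW
  set AO : Set (BondConfig (Fin n)) := ⋃ s ∈ S \ T, openConn s o with hAO
  set AB : Set (BondConfig (Fin n)) := ⋂ t ∈ T, openConn t b with hAB
  have key := knThm2_bhkTwo stub_bhkSets.2 w (S \ T) T o b Finset.sdiff_disjoint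
  -- key : μ.real W * μ.real (W ∩ (AO ∩ AB)) ≤ μ.real (W ∩ AO) * μ.real (W ∩ AB)
  change μ.real W * μ.real (W ∩ (AO ∩ AB)) ≤ μ.real (W ∩ AO) * μ.real (W ∩ AB) at key
  change μ.real (W ∩ (AO ∩ AB)) ≤ μ.real (W ∩ AB) * (μ.real (W ∩ AO) / μ.real W)
  rcases (measureReal_nonneg : 0 ≤ μ.real W).eq_or_lt with h0 | hpos
  · -- `μ(W) = 0`: the piece is null
    have h1 : μ.real (W ∩ (AO ∩ AB)) ≤ μ.real W := measureReal_mono Set.inter_subset_left (measure_ne_top _ _)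
    have h2 : 0 ≤ μ.real (W ∩ AB) * (μ.real (W ∩ AO) / μ.real W) :=
      mul_nonneg measureReal_nonneg (div_nonneg measureReal_nonneg measureReal_nonneg)
    linarith
  · rw [← mul_div_assoc, le_div_iff₀ hpos]
    calc μ.real (W ∩ (AO ∩ AB)) * μ.real W = μ.real W * μ.real (W ∩ (AO ∩ AB)) := mul_comm _ _
      _ ≤ μ.real (W ∩ AO) * μ.real (W ∩ AB) := key
      _ = μ.real (W ∩ AB) * μ.real (W ∩ AO) := mul_comm _ _

end

end Summit.CriticalPhenomena.PercolationContinuityZ3.Theorems
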